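import Literature.Topology.FourManifolds.TrisectionFunctor
import HarnessLib

/-!
# The Abrams–Gay–Kirby functor on Gay–Kirby trisections with corners: corrected named facts

Topic `Literature/Topology/FourManifolds`; companion to `TrisectionFunctor.lean` (fact item
`provefact-Literature.diffeomorph_of_iso_groupTrisectionOf`, Abrams–Gay–Kirby 2018, Thm. 5).

## Why this file exists

`TrisectionFunctor.lean` defines the kernel triple `groupTrisectionOf h x₀ μ` of a trisected
4-manifold and records Abrams–Gay–Kirby's results about it as named facts (a)–(g), all phrased over
`h : IsBalancedTrisection X g k S`.  That predicate is **unsatisfiable**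
(`Literature.Topology.FourManifolds.TrisectionRefutation.not_isBalancedTrisection`): clause (ii) of `IsTrisection` asks for
sectors that are smoothly embedded manifolds *with boundary*, whereas the sectors `Xᵢ` of a
Gay–Kirby trisection have corners along the central surface `F = X₁ ∩ X₂ ∩ X₃`.  Hence facts
(a), (b), (c), (g) are vacuously true and (d), (e) are false as stated
(`TrisectionFunctorProofs.lean`), and none of them carries the printed mathematics.  The corrected
predicate `IsGKTrisection` / `IsBalancedGKTrisection` (`Trisections.lean`: sectors topologically
embedded `1`-handlebodies, `C^∞`-immersed off `F`, with an explicit corner chart at the points of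
`F`) is the tree's faithful reading of Gay–Kirby's Def. 1.  This file re-vendors the functor and
the facts over it, under new names and otherwise **verbatim** (same binders, same conclusions):

| `TrisectionFunctor.lean` (over `IsBalancedTrisection`) | here (over `IsBalancedGKTrisection`) |
|---|---|
| `groupTrisectionOf` | `groupGKTrisectionOf` |
| (a) `isGroupTrisection_groupTrisectionOf` | (a') `isGroupTrisection_groupGKTrisectionOf` |
| (b) `diffeomorph_of_iso_groupTrisectionOf` | (b') `diffeomorph_of_iso_groupGKTrisectionOf` |
| (c) `exists_stabilized_trisection` | (c') `exists_stabilized_gkTrisection` |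
| (d) `sphere_trisections` | (d') `sphere_gkTrisections` |
| (e) `exists_trisected_of_isGroupTrisection` | (e') `exists_gkTrisected_of_isGroupTrisection` |
| (g) `exists_marking_centralSurface` | (g') `exists_marking_centralSurface_of_gkTrisection` |

((f) `spc4_iff_forall_isStablyTrivial`, AGK Cor. 6, mentions no trisected manifold and needs no
correction.)  None of (a')–(e'), (g') is proved here: (b') and (e') are Abrams–Gay–Kirby's Theorem 5
(handlebody fillings realising epimorphisms `S_g ↠ F_g`, Dehn's lemma, Kneser–Stallings and the
Poincaré conjecture to recognise `#ᵏ(S¹ × S²)`, Laudenbach–Poénaru), far beyond the tree.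

## The source, as printed (Abrams–Gay–Kirby 2018; pages of Geom. Topol. 22)

* Def. 1 (p. 1538): a `(g, k)`-trisection of a group `G` is a commutative cube of groups
  `S_g → H_g (×3) → Z_k (×3) → G`, "such that each homomorphism is surjective and each face is a
  pushout"; "An isomorphism from a trisection `({G_v}, {f_e})` of `G` to a trisection
  `({G'_v}, {f'_e})` of `G'` is a collection of isomorphisms `h_v : G_v → G'_v`, for all `v ∈ V`,
  commuting with the `f_e`'s and `f'_e`'s."  Since all `f_e` are surjective the cube is determined
  by the three kernels `Kᵢ = ker (S_g → H_g)`, and an isomorphism is exactly an automorphism `α`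
  of `S_g` with `α(Kᵢ) = K'ᵢ` (the other `h_v` are induced) — the tree's `TrisectionKernels.Iso`
  and `IsGroupTrisection` (`GroupTrisections.lean`).  No orientation condition is printed.
* p. 1540: based (`p ∈ X₁ ∩ X₂ ∩ X₃`) and *parametrized* trisections (fixed diffeomorphisms of the
  pieces with the standard models, respecting base points and inclusions); "There is an obvious
  map from the set of parametrized based trisected 4-manifolds to the set of trisected groups,
  which we will call `𝒢`"; "The main result of this paper is that `𝒢` induces a bijection between
  trisected 4-manifolds up to trisected diffeomorphism and trisected groups up to trisected
  isomorphism, and that this bijection respects stabilizations in both categories."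
* Thm. 5 (p. 1541): "There exists a map `ℳ` from the set of trisected groups to the set of (based,
  parametrized) trisected 4-manifolds such that `ℳ ∘ 𝒢` is the identity up to trisected
  diffeomorphism and `𝒢 ∘ ℳ` is the identity up to trisected isomorphism.  The unique
  `(0, 0)`-trisection of `{1}` maps to the unique `(0, 0)`-trisection of `S⁴`, the standard
  `(3, 1)`-trisection of `{1}` maps to the standard `(3, 1)`-trisection of `S⁴`, and connected
  sums of group trisections map to connected sums of 4-manifold trisections.  Thus `ℳ` induces a
  bijection between the set of trisected groups modulo isomorphism and stabilization and the set
  of smooth, closed, connected, oriented 4-manifolds modulo orientation preserving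
  diffeomorphism."

**Markings versus parametrizations.**  `𝒢` reads `S_g = π₁(F, p)` through the parametrization
of `F`; the Lean kernel triple takes an abstract marking `μ : S_g ≃* π₁(F, x₀)` instead.  Any two
markings differ by an automorphism of `S_g`, which changes the kernel triple by an `Iso`
(`groupGKTrisectionOf_iso_of_markings`); as `Iso` is an equivalence relation
(`TrisectionKernels.Iso.symm/trans`) allowing every automorphism of `S_g` — exactly as the printed
isomorphisms do — hypotheses and conclusions of the form "`Iso (groupGKTrisectionOf …) (…)`" are
insensitive to the choice of marking, so (a')–(e') say precisely what is printed for parametrized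
trisections.  Because a group-trisection isomorphism may come from an orientation-reversing
identification of central surfaces, (b') only concludes an *unoriented* diffeomorphism
`Nonempty (X ≃ₘ X')`, which the printed statements imply under any reading of "trisected
isomorphism".

## References

* A. Abrams, D. Gay, R. Kirby, *Group trisections and smooth 4-manifolds*, Geom. Topol. 22 (2018)
  1537–1545 (arXiv:1605.06731): Def. 1 and isomorphism of trisections, p. 1538; Def. 2–4,
  pp. 1539–1540; the map `𝒢`, p. 1540; Thm. 5 and Cor. 6, p. 1541; proof of Thm. 5, pp. 1541–1542.
* D. Gay, R. Kirby, *Trisecting 4-manifolds*, Geom. Topol. 20 (2016) 3097–3132: Def. 1 (p. 3098),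
  Def. 8 (stabilisation, p. 3099), Def. 9 and Fig. 3 (the genus-`3` trisection of `S⁴`, p. 3100),
  Lemma 10 (p. 3100).
* A. Hatcher, *Algebraic Topology*, CUP 2002, §1.2 (p. 51), Prop. 1.26 (`π₁` of `Σ_g`).
-/

noncomputable section

open Set
open scoped Manifold ContDiff

namespace Literature.Topology.FourManifolds

universe u

/-! ### `Iso` is an equivalence relation -/

namespace TrisectionKernels

variable {g : ℕ} {K K' K'' : TrisectionKernels g}

/-- Isomorphism of kernel triples is symmetric (invert the automorphism of `S_g`). [folklore] -/
theorem Iso.symm (h : K.Iso K') : K'.Iso K := by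
  obtain ⟨α, hα⟩ := h
  refine ⟨α.symm, fun i => ?_⟩
  have hcomp : α.symm.toMonoidHom.comp α.toMonoidHom = MonoidHom.id _ :=
    MonoidHom.ext fun γ => by simp
  rw [← hα i, Subgroup.map_map, hcomp, Subgroup.map_id]

/-- Isomorphism of kernel triples is transitive (compose the automorphisms of `S_g`). [folklore] -/
theorem Iso.trans (h : K.Iso K') (h' : K'.Iso K'') : K.Iso K'' := by
  obtain ⟨α, hα⟩ := h
  obtain ⟨β, hβ⟩ := h'
  refine ⟨α.trans β, fun i => ?_⟩
  have hcomp : (α.trans β).toMonoidHom = β.toMonoidHom.comp α.toMonoidHom :=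
    MonoidHom.ext fun _ => rfl
  rw [hcomp, ← Subgroup.map_map, hα i, hβ i]

end TrisectionKernels

/-! ### The kernel triple of a Gay–Kirby trisection -/

section Functor

variable {X : Type u} [TopologicalSpace X] [ChartedSpace (EuclideanSpace ℝ (Fin 4)) X]
  {g : ℕ} {k : Fin 3 → ℕ} {S : Fin 3 → Set X}

/-- **The Abrams–Gay–Kirby kernel triple of a Gay–Kirby trisection** (sectors with corners along
the central surface): for `h : IsGKTrisection X g k S`, a base point `x₀ ∈ F = ⋂ S l` and a marking
`μ : S_g ≃* π₁(F, x₀)`, `groupGKTrisectionOf h x₀ μ i = μ⁻¹ (ker (π₁(F, x₀) → π₁(Hᵢ, x₀)))` with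
`Hᵢ = S (i+1) ∩ S (i+2)` the handlebody opposite to the sector `S i` and the map induced by the
inclusion `F ⊆ Hᵢ` (`centralInclusion`).  Same formula as `groupTrisectionOf` (whose hypothesis
`IsTrisection` cannot be met); `h` is carried for meaning only.  This is the map `𝒢` of
Abrams–Gay–Kirby in kernel form ("the groups are the fundamental groups of the `Xᵢ`'s and their
intersections … and the maps are those induced by inclusions composed with parametrizations").
[cite: AbramsGayKirby2018, p. 1540 (the map 𝒢)] -/
def groupGKTrisectionOf (_h : IsGKTrisection X g k S) (x₀ : centralSurface S)
    (μ : SurfaceGroup g ≃* FundamentalGroup (centralSurface S) x₀) : TrisectionKernels g :=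
  fun i => ((FundamentalGroup.map (centralInclusion S i) x₀).ker).comap μ.toMonoidHom

/-- Unfolding: `γ ∈ Kᵢ` iff the loop `μ γ` dies in `π₁(Hᵢ, x₀)`. [folklore] -/
theorem mem_groupGKTrisectionOf_iff (h : IsGKTrisection X g k S) (x₀ : centralSurface S)
    (μ : SurfaceGroup g ≃* FundamentalGroup (centralSurface S) x₀) (i : Fin 3) (γ : SurfaceGroup g) :
    γ ∈ groupGKTrisectionOf h x₀ μ i ↔ FundamentalGroup.map (centralInclusion S i) x₀ (μ γ) = 1 :=
  Iff.rfl

/-- The kernels `Kᵢ` are normal subgroups of `S_g` (preimages of kernels). [folklore] -/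
theorem groupGKTrisectionOf_normal (h : IsGKTrisection X g k S) (x₀ : centralSurface S)
    (μ : SurfaceGroup g ≃* FundamentalGroup (centralSurface S) x₀) (i : Fin 3) :
    (groupGKTrisectionOf h x₀ μ i).Normal := by
  unfold groupGKTrisectionOf
  infer_instance

/-- Changing the marking by an automorphism of `S_g` changes the kernel triple by an isomorphism
(Abrams–Gay–Kirby's isomorphisms of trisections are arbitrary compatible families of group
isomorphisms, Def. 1, p. 1538). [cite: AbramsGayKirby2018, Def. 1 (p. 1538, isomorphism of trisections)] -/
theorem groupGKTrisectionOf_iso_of_marking (h : IsGKTrisection X g k S) (x₀ : centralSurface S)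
    (μ : SurfaceGroup g ≃* FundamentalGroup (centralSurface S) x₀) (α : SurfaceGroup g ≃* SurfaceGroup g) :
    TrisectionKernels.Iso (groupGKTrisectionOf h x₀ (α.trans μ)) (groupGKTrisectionOf h x₀ μ) := by
  refine ⟨α, fun i => ?_⟩
  ext γ
  simp only [groupGKTrisectionOf, Subgroup.mem_map, Subgroup.mem_comap, MulEquiv.coe_toMonoidHom,
    MulEquiv.trans_apply]
  constructor
  · rintro ⟨δ, hδ, rfl⟩
    exact hδ
  · intro hγ
    exact ⟨α.symm γ, by simpa using hγ, by simp⟩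

/-- Any two markings of the central surface at the same base point give isomorphic kernel triples
(they differ by the automorphism `μ ∘ μ₀⁻¹` of `S_g`).  Hence statements of the form
`Iso (groupGKTrisectionOf h x₀ μ) _` do not depend on the marking, in particular agree with the one
induced by an Abrams–Gay–Kirby parametrization of `F`. [folklore] -/
theorem groupGKTrisectionOf_iso_of_markings (h : IsGKTrisection X g k S) (x₀ : centralSurface S)
    (μ μ₀ : SurfaceGroup g ≃* FundamentalGroup (centralSurface S) x₀) :
    TrisectionKernels.Iso (groupGKTrisectionOf h x₀ μ) (groupGKTrisectionOf h x₀ μ₀) := by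
  have hμ : (μ.trans μ₀.symm).trans μ₀ = μ := by
    ext γ
    simp
  rw [← hμ]
  exact groupGKTrisectionOf_iso_of_marking h x₀ μ₀ (μ.trans μ₀.symm)

end Functor

/-! ### Named facts (a')–(e'), (g') over `IsBalancedGKTrisection` -/

/-- **(a') Abrams–Gay–Kirby, p. 1540 (the map `𝒢`) and Thm. 5.**  For a balanced
`(g, k)`-trisection (with corners along the central surface, `IsBalancedGKTrisection`) of a closed
connected oriented smooth 4-manifold, the kernel triple is a `(g, k)` group trisection of
`π₁(X, x₀)`: the `Hᵢ` are genus-`g` handlebodies with connected boundary `F`, so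
`S_g ↠ π₁ Hᵢ ≅ F_g`; `Hᵢ ∪_F Hⱼ = ∂X_l ≅ #ᵏ(S¹ × S²)` and `π₁(∂X_l) ≅ π₁(X_l) ≅ F_k`, so the
pairwise pushouts are free of rank `k`; by van Kampen the triple pushout is `π₁ X`.  Print,
p. 1540: "There is an obvious map from the set of parametrized based trisected 4-manifolds to the
set of trisected groups, which we will call `𝒢`; the groups are the fundamental groups of the
`Xᵢ`'s and their intersections".  Corrected form of `isGroupTrisection_groupTrisectionOf`
(verbatim, `IsBalancedTrisection ↦ IsBalancedGKTrisection`).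
[cite: AbramsGayKirby2018, Thm. 5 (p. 1541) and p. 1540 (the map 𝒢)] -/
def isGroupTrisection_groupGKTrisectionOf : Prop :=
  ∀ (X : Type u) [TopologicalSpace X] [T2Space X] [SecondCountableTopology X]
    [ChartedSpace (EuclideanSpace ℝ (Fin 4)) X] [IsManifold (𝓡 4) ∞ X] [CompactSpace X]
    [ConnectedSpace X] (_ : SmoothOrientation (𝓡 4) X) (g k : ℕ) (S : Fin 3 → Set X)
    (h : IsBalancedGKTrisection X g k S) (x₀ : centralSurface S)
    (μ : SurfaceGroup g ≃* FundamentalGroup (centralSurface S) x₀),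
    IsGroupTrisection g k (FundamentalGroup X (x₀ : X)) (groupGKTrisectionOf h x₀ μ)

/-- **(b') Abrams–Gay–Kirby, Thm. 5 (rigidity: a trisected 4-manifold is determined up to
diffeomorphism by its group trisection).**  Two closed connected oriented smooth 4-manifolds
carrying balanced `(g, k)`-trisections (with corners along the central surface,
`IsBalancedGKTrisection`) whose kernel triples are isomorphic are diffeomorphic.  Print, Thm. 5,
p. 1541: "`ℳ ∘ 𝒢` is the identity up to trisected diffeomorphism and `𝒢 ∘ ℳ` is the identity up
to trisected isomorphism"; p. 1540: "`𝒢` induces a bijection between trisected 4-manifolds up to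
trisected diffeomorphism and trisected groups up to trisected isomorphism" — (b') is the
injectivity of this bijection (isomorphism of trisected groups in the printed sense of Def. 1 is
`TrisectionKernels.Iso`; the marking is immaterial by `groupGKTrisectionOf_iso_of_markings`), with
the weaker, unoriented conclusion `Nonempty (X ≃ₘ X')`.  Corrected form of the vacuous
`diffeomorph_of_iso_groupTrisectionOf` (verbatim, `IsBalancedTrisection ↦ IsBalancedGKTrisection`);
not proved in the tree (Waldhausen, Laudenbach–Poénaru, Kneser–Stallings–Perelman).
[cite: AbramsGayKirby2018, Thm. 5 (p. 1541)] -/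
def diffeomorph_of_iso_groupGKTrisectionOf : Prop :=
  ∀ (X : Type u) [TopologicalSpace X] [T2Space X] [SecondCountableTopology X]
    [ChartedSpace (EuclideanSpace ℝ (Fin 4)) X] [IsManifold (𝓡 4) ∞ X] [CompactSpace X]
    [ConnectedSpace X] (_ : SmoothOrientation (𝓡 4) X)
    (X' : Type u) [TopologicalSpace X'] [T2Space X'] [SecondCountableTopology X']
    [ChartedSpace (EuclideanSpace ℝ (Fin 4)) X'] [IsManifold (𝓡 4) ∞ X'] [CompactSpace X']
    [ConnectedSpace X'] (_ : SmoothOrientation (𝓡 4) X')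
    (g k : ℕ) (S : Fin 3 → Set X) (S' : Fin 3 → Set X')
    (h : IsBalancedGKTrisection X g k S) (h' : IsBalancedGKTrisection X' g k S')
    (x₀ : centralSurface S) (x₀' : centralSurface S')
    (μ : SurfaceGroup g ≃* FundamentalGroup (centralSurface S) x₀)
    (μ' : SurfaceGroup g ≃* FundamentalGroup (centralSurface S') x₀'),
    TrisectionKernels.Iso (groupGKTrisectionOf h x₀ μ) (groupGKTrisectionOf h' x₀' μ') →
      Nonempty (X ≃ₘ⟮𝓡 4, 𝓡 4⟯ X')

/-- **(c') Stabilisation compatibility (Gay–Kirby 2016, Def. 8, Lemma 10; Abrams–Gay–Kirby 2018,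
Def. 3 and Thm. 5).**  A balanced `(g, k)`-trisected (with corners, `IsBalancedGKTrisection`)
closed connected oriented 4-manifold admits a balanced `(g+3, k+1)`-trisection (the Gay–Kirby
stabilisation, i.e. the connected sum with the genus-`3` trisection of `S⁴`) whose kernel triple
is isomorphic to the algebraic stabilisation `TrisectionKernels.stabilize` of the original one.
Print, AGK Thm. 5, p. 1541: "connected sums of group trisections map to connected sums of
4-manifold trisections"; Def. 3, p. 1540: "The stabilization of a group trisection is the
connected sum of the given trisection with the standard trivial `(3, 1)`-trisection."  Corrected
form of `exists_stabilized_trisection` (verbatim, `IsBalancedTrisection ↦ IsBalancedGKTrisection`).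
[cite: AbramsGayKirby2018, Def. 3 (p. 1540) and Thm. 5 (p. 1541)] -/
def exists_stabilized_gkTrisection : Prop :=
  ∀ (X : Type u) [TopologicalSpace X] [T2Space X] [SecondCountableTopology X]
    [ChartedSpace (EuclideanSpace ℝ (Fin 4)) X] [IsManifold (𝓡 4) ∞ X] [CompactSpace X]
    [ConnectedSpace X] (_ : SmoothOrientation (𝓡 4) X) (g k : ℕ) (S : Fin 3 → Set X)
    (h : IsBalancedGKTrisection X g k S) (x₀ : centralSurface S)
    (μ : SurfaceGroup g ≃* FundamentalGroup (centralSurface S) x₀),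
    ∃ (S' : Fin 3 → Set X) (h' : IsBalancedGKTrisection X (g + 3) (k + 1) S')
      (x₀' : centralSurface S') (μ' : SurfaceGroup (g + 3) ≃* FundamentalGroup (centralSurface S') x₀'),
      TrisectionKernels.Iso (groupGKTrisectionOf h' x₀' μ') (groupGKTrisectionOf h x₀ μ).stabilize

/-- **(d') The standard trisections of the round `S⁴` (Gay–Kirby 2016, §1).**  For every `m`, the
unit sphere `S⁴ ⊆ ℝ⁵` (Mathlib's smooth structure) admits a balanced `(3 + 3m, 1 + m)`-trisection
with corners along the central surface (`IsBalancedGKTrisection`) whose kernel triple is isomorphic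
to the `m`-fold algebraic stabilisation `s4Kernels.stabilizeIter m` of the genus-`3` `S⁴` triple
(Gay–Kirby's genus-`3n` trisections of `S⁴` are the stabilisations of the genus-`0` one).  Print,
AGK Thm. 5, p. 1541: "the standard `(3, 1)`-trisection of `{1}` maps to the standard
`(3, 1)`-trisection of `S⁴`, and connected sums of group trisections map to connected sums of
4-manifold trisections".  Corrected form of the refuted `sphere_trisections` (verbatim,
`IsBalancedTrisection ↦ IsBalancedGKTrisection`). [cite: GayKirby2016, Def. 9 and Fig. 3 (p. 3100)] -/
def sphere_gkTrisections : Prop :=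
  ∀ m : ℕ, ∃ (S : Fin 3 → Set (Metric.sphere (0 : EuclideanSpace ℝ (Fin 5)) 1))
    (h : IsBalancedGKTrisection (Metric.sphere (0 : EuclideanSpace ℝ (Fin 5)) 1) (3 + 3 * m) (1 + m) S)
    (x₀ : centralSurface S)
    (μ : SurfaceGroup (3 + 3 * m) ≃* FundamentalGroup (centralSurface S) x₀),
    TrisectionKernels.Iso (groupGKTrisectionOf h x₀ μ) (s4Kernels.stabilizeIter m)

/-- **(e') Abrams–Gay–Kirby, Thm. 5 (the map `ℳ`: group trisections → trisected 4-manifolds, with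
`𝒢 ∘ ℳ = id` up to isomorphism).**  Every `(g, k)` group trisection of a group `G` is isomorphic
to the kernel triple `groupGKTrisectionOf` of a balanced `(g, k)`-trisection (with corners,
`IsBalancedGKTrisection`) of some closed, connected, oriented smooth 4-manifold (whose fundamental
group is then `G`, by (a')).  Print, Thm. 5, p. 1541: "There exists a map `ℳ` from the set of
trisected groups to the set of (based, parametrized) trisected 4-manifolds such that … `𝒢 ∘ ℳ`
is the identity up to trisected isomorphism."  Corrected form of the refuted
`exists_trisected_of_isGroupTrisection` (verbatim, `IsBalancedTrisection ↦ IsBalancedGKTrisection`).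
[cite: AbramsGayKirby2018, Thm. 5 (p. 1541)] -/
def exists_gkTrisected_of_isGroupTrisection : Prop :=
  ∀ (g k : ℕ) (G : Type u) [Group G] (K : TrisectionKernels g), IsGroupTrisection g k G K →
    ∃ (X : Type u) (_ : TopologicalSpace X) (_ : T2Space X) (_ : SecondCountableTopology X)
      (_ : ChartedSpace (EuclideanSpace ℝ (Fin 4)) X) (_ : IsManifold (𝓡 4) ∞ X)
      (_ : CompactSpace X) (_ : ConnectedSpace X) (_ : SmoothOrientation (𝓡 4) X)
      (S : Fin 3 → Set X) (h : IsBalancedGKTrisection X g k S) (x₀ : centralSurface S)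
      (μ : SurfaceGroup g ≃* FundamentalGroup (centralSurface S) x₀),
      TrisectionKernels.Iso (groupGKTrisectionOf h x₀ μ) K

/-- **(g') The central surface of a balanced Gay–Kirby trisection is a non-empty closed genus-`g`
surface, so a marking exists.**  For a balanced `(g, k)`-trisection `S` (with corners,
`IsBalancedGKTrisection`) of a closed, connected, oriented smooth 4-manifold `X`, the central
surface `F = ⋂ l, S l` has a point `x₀` and an isomorphism `S_g ≃* π₁(F, x₀)`: by clause (iii),
`F = h(∂H)` for a smoothly embedded compact connected `3`-dimensional `1`-handlebody `H` with `g`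
`1`-handles, lying in the boundary of the orientable sector `e(W)` and hence orientable, so
`F ≅ Σ_g` (Gay–Kirby Def. 1: "`F_g = X₁ ∩ X₂ ∩ X₃` is a closed genus-`g` surface"), non-empty,
with `π₁(Σ_g) ≅ ⟨a₁, b₁, …, a_g, b_g ∣ ∏ᵢ [aᵢ, bᵢ]⟩` (Hatcher §1.2, p. 51).  Corrected form of
`exists_marking_centralSurface` (verbatim, `IsBalancedTrisection ↦ IsBalancedGKTrisection`).
[cite: GayKirby2016, Def. 1] [cite: Hatcher2002, §1.2 p. 51 and Prop. 1.26] -/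
def exists_marking_centralSurface_of_gkTrisection : Prop :=
  ∀ (X : Type u) [TopologicalSpace X] [T2Space X] [SecondCountableTopology X]
    [ChartedSpace (EuclideanSpace ℝ (Fin 4)) X] [IsManifold (𝓡 4) ∞ X] [CompactSpace X]
    [ConnectedSpace X] (_ : SmoothOrientation (𝓡 4) X) (g k : ℕ) (S : Fin 3 → Set X),
    IsBalancedGKTrisection X g k S →
      ∃ x₀ : centralSurface S, Nonempty (SurfaceGroup g ≃* FundamentalGroup (centralSurface S) x₀)

/-- Consumer form of (g') + (a'): under the two named facts, a balanced Gay–Kirby trisection of a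
closed connected oriented smooth 4-manifold yields some base point, marking and `(g, k)` group
trisection of `π₁(X, x₀)`. [cite: AbramsGayKirby2018, Thm. 5 (p. 1541)] -/
theorem exists_isGroupTrisection_of_isBalancedGKTrisection
    (hg : exists_marking_centralSurface_of_gkTrisection.{u})
    (ha : isGroupTrisection_groupGKTrisectionOf.{u})
    (X : Type u) [TopologicalSpace X] [T2Space X] [SecondCountableTopology X]
    [ChartedSpace (EuclideanSpace ℝ (Fin 4)) X] [IsManifold (𝓡 4) ∞ X] [CompactSpace X]
    [ConnectedSpace X] (o : SmoothOrientation (𝓡 4) X) (g k : ℕ) (S : Fin 3 → Set X)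
    (h : IsBalancedGKTrisection X g k S) :
    ∃ (x₀ : centralSurface S) (μ : SurfaceGroup g ≃* FundamentalGroup (centralSurface S) x₀),
      IsGroupTrisection g k (FundamentalGroup X (x₀ : X)) (groupGKTrisectionOf h x₀ μ) := by
  obtain ⟨x₀, ⟨μ⟩⟩ := hg X o g k S h
  exact ⟨x₀, μ, ha X o g k S h x₀ μ⟩

/-- Consumer form of (b'): under the rigidity fact, the diffeomorphism type of a balanced
Gay–Kirby-trisected closed connected oriented smooth 4-manifold is determined by the isomorphism
class of its kernel triple, for ANY choice of markings on the two sides (the markings are absorbed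
by `groupGKTrisectionOf_iso_of_markings`). [cite: AbramsGayKirby2018, Thm. 5 (p. 1541)] -/
theorem nonempty_diffeomorph_of_iso_groupGKTrisectionOf
    (hb : diffeomorph_of_iso_groupGKTrisectionOf.{u})
    {X : Type u} [TopologicalSpace X] [T2Space X] [SecondCountableTopology X]
    [ChartedSpace (EuclideanSpace ℝ (Fin 4)) X] [IsManifold (𝓡 4) ∞ X] [CompactSpace X]
    [ConnectedSpace X] (o : SmoothOrientation (𝓡 4) X)
    {X' : Type u} [TopologicalSpace X'] [T2Space X'] [SecondCountableTopology X']
    [ChartedSpace (EuclideanSpace ℝ (Fin 4)) X'] [IsManifold (𝓡 4) ∞ X'] [CompactSpace X']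
    [ConnectedSpace X'] (o' : SmoothOrientation (𝓡 4) X')
    {g k : ℕ} {S : Fin 3 → Set X} {S' : Fin 3 → Set X'}
    (h : IsBalancedGKTrisection X g k S) (h' : IsBalancedGKTrisection X' g k S')
    (x₀ : centralSurface S) (x₀' : centralSurface S')
    (μ : SurfaceGroup g ≃* FundamentalGroup (centralSurface S) x₀)
    (μ' : SurfaceGroup g ≃* FundamentalGroup (centralSurface S') x₀')
    {K : TrisectionKernels g} (hK : TrisectionKernels.Iso (groupGKTrisectionOf h x₀ μ) K)
    (hK' : TrisectionKernels.Iso (groupGKTrisectionOf h' x₀' μ') K) :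
    Nonempty (X ≃ₘ⟮𝓡 4, 𝓡 4⟯ X') :=
  hb X o X' o' g k S S' h h' x₀ x₀' μ μ' (hK.trans hK'.symm)

end Literature.Topology.FourManifolds
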